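/- Copyright: the b2b-balaban cell (near-miss cell 7), T⁴-continuum fan-out, lineage t4-ne7b-formalise-leaf-06 (NE7b CRUX
TEAM (2) leaf prover 06), gen 33: «THE VOLUME WINDOW», file 1∕2.  Released under the licence of the surrounding project. -/
import Summits.QuantumFields.BalabanUV.T4Continuum.Support.HistoryBankingSharpShares

/-!
# History banking, M5-2 (c) supplier, file 1∕2: PRINT'S VOLUME LETTER `u_t = cΛ·ℓ_{t∧K}` AND THE VOLUME WINDOW — the
calibration displays `hu ∕ hLu0 ∕ hj1 ∕ hLu ∕ hsmall ∕ huΦ ∕ huE₂ ∕ huE₃` of `HistoryBankingVolumePlug` (OWNER t4-ne7b-p1 g44,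
M5-2c) and the volume-slack display `huV` DISCHARGED at that letter on ONE K-uniform coupling window (route R-P1 of row
NE7b; INTERFACE REQUEST IR-48-2 of RULING R-OWNER-48-1, «THE VOLUME WINDOW»; re-open object (α))

Summits-side support leaf of the T⁴-continuum cell (rung (B)+1 on a FINITE torus only; NOT infinite volume, NOT the
mass gap, NOT the Clay statement; NOT a proof of the spine estimate NE7b — the cell's OWN estimate, NOT PRINTED, NOT
PROVED).  [folklore] real arithmetic over the sibling `HistoryBankingSharpShares` (`ell`, `p0Profile_eq`), the printed
shape letters (`T4PrintedShapeBanking.{Consts, floorK}`, `Setup.p0Profile`) and the typed flow inequality (2.7)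
(`B14.FlowIneq27`); no `[cite:]` tag, nothing printed asserted, no `def … : Prop`, zero `sorry`.

WHY.  The (α) assembly's input record (`HistoryRealiseCellsRunAssemblyWTVSData.HistReadData`, its guarded twin
`HistReadDataL`) carries, per cutoff `K ≥ K₀`, M5-2's volume calibration as SEVEN DISPLAYED FIELDS over the per-cube level
cost `Λ K t` of M2 brick B (`B16HistoryInputFamily.HistFactors.Λ`): `hLu0 : 0 < Lu K`, `hj1 : 1 ≤ jl K`,
`hLu : log Λ K (t+i) ≤ Lu K·log Λ K t` (`i ≤ jl K`), `hsmall : 1122^d·16·21^d·Lu K ≤ 2^{jl K}∕2`,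
`huΦ : log Λ K t·6(561^d·jl K·Lu K + 1122^d·Lu K) ≤ floorK C K (R K) t`, `huE₂ : log Λ K m·15·126^d ≤ E₂·R_m^{q′}`,
`huE₃ : log Λ K m·24·126^d ≤ E₃·R_m^{q′}` (`t, m ≤ K`), and the volume-slack display `huV : 2^{d+3}·log Λ K j ≤ θᵥ·p₀(g_j)²`
at the priced members' births — with the calibration `Lu`, `jl` free.  [B16] p. 380 (LOCATOR, the constants line before
(1.76); `B16LargeFieldFactors380.vacuumLine380`): «every large field domain Z_j contributes the constant O(1) log g_j⁻²|Z_j|»,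
read by the row OWNER (`B16HistoryInputFamily`, docstring of `HistFactors`) as `Λ K j = exp(O(1)·log g_j⁻²)` per cube.
THIS FILE instantiates: the weight **`uvol cΛ g K t = cΛ·ℓ_{t∧K}`** (`ℓ_j = log g_j⁻²`, the level capped at the cutoff —
levels beyond `K` are not performed), the pinned cost **`lamVol = exp ∘ uvol`**, the growth constant **`Lu := 1 + β₀`** (from
(2.7) with `p = 1`: `ℓ_n ≤ (1+β₀)ℓ_m`, `m < n ≤ K`), the lag **`jl := jvol d (1+β₀)`** (the least-power-of-two choice making
`hsmall` an identity of the definition), and proves the seven displays + `huV` from the LOWER (2.5) envelope `ℓ_t^{r} ≤ R_t`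
(the second conjunct of `B14.IsRj`) on ONE displayed window `VolumeWindow` of four clauses «constant·cΛ ≤ constant·ℓ_j^{gap}»
— the sibling `HistoryBankingVolumeSupply` reduces the window to ONE threshold `ℓ_j ≥ ℓ⋆ᵥ`, hence to the couplings
`0 < g_j ≤ γ ≤ e^{−ℓ⋆ᵥ∕2}`, exactly as `HistoryBankingRoundingSupply` does for the rounding window.

WHAT.  §1 letters `uvol`, `lamVol`, `jvol` (+ `uvol_of_le`, `uvol_nonneg`, `log_lamVol`, `one_le_lamVol`, `one_le_jvol`,
**`hsmall_jvol`**).  §2 (2.7) ⇒ the capped letter grows by at most `1 + β₀`: `ell_later_le_of_flowIneq27_one` (p = 1 as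
printed), **`ell_later_le_of_flowIneq27`** (any exponent `p ≥ 1`, the form `HistoryFlow.flowBinders_of_tuned` supplies at
`p₀`), **`uvol_later_le`** (`hLu` for EVERY lag).  §3 **`structure VolumeWindow C d K r κ₂ κᵥ cΛ θᵥ Lu jl g`** (HYPOTHESIS
SHAPE: bookkeeping `1 + κ₂ = r·q′`, `1 + κᵥ = 2p₀`, `1 ≤ ℓ_j`, and (WV1) `6(561^d·jl·Lu + 1122^d·Lu)·cΛ ≤ E₂·ℓ_j^{κ₂}`, (WV2)
`15·126^d·cΛ ≤ E₂·ℓ_j^{κ₂}`, (WV3) `24·126^d·cΛ ≤ E₃·ℓ_j^{κ₂}`, (WV4) `2^{d+3}·cΛ ≤ θᵥ·A₀²·ℓ_j^{κᵥ}`, all `j ≤ K`); the four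
value displays at the letter: **`huΦ_uvol`**, **`huE₂_uvol`**, **`huE₃_uvol`**, **`huV_uvol`**.  §4 the bundle
**`structure VolumeDisplays C d K R u Lu jl`** (= M5-2c's eight binders `hu hLu0 hj1 hLu hsmall huΦ huE₂ huE₃` VERBATIM, `u`
abstract) and **`volumeDisplays_sharp : VolumeDisplays C d K R (uvol cΛ g K) (1 + β₀) (jvol d (1 + β₀))`**; the record-facing
forms for a per-cube cost PINNED at the letter, `log (Λ t) = uvol cΛ g K t` (e.g. `Λ := lamVol cΛ g K`):
**`volumeDisplays_of_log_eq`**, **`huV_of_log_eq`** (conclusions literally the `HistReadData` field shapes at one `K`),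
`huV_events_of_log_eq` (lifted over a member's kind-`0` events at performed steps), `volumeDisplays_lamVol`, `huV_lamVol`;
helpers `letter_mul_le_of_clause`, `ell_pow_mul_le`.

LOCATED (design, for the OWNER ∕ custodian; no return): `hLu` is TWO-SIDED in `log Λ` — an upper envelope
`log Λ K t ≤ cΛ·ℓ_t` alone does not give it for `log Λ` itself; for the record AS TYPED print's letter therefore enters as
the VALUE of `Λ` (pinned, `Λ := lamVol`: p. 380's first member moves into `HistRead`'s forest display, H3) or through a
two-sided envelope `c₁·ℓ ≤ log Λ ≤ cΛ·ℓ` (a staged variant, `Lu := (cΛ∕c₁)(1+β₀)`; the OWNER's SPEC D-48-1 «THE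
PREFIX TWIN» takes the pinned route: ONE display `hΛ : log (Φf.Λ K t) = uvol cΛ (flow.g) K t`).

HONEST SCOPE.  Real arithmetic over OUR carriers; `VolumeWindow` is a HYPOTHESIS shape (a smallness of OUR letters,
reducible to `g_j ≤ γ ≤ e^{−ℓ⋆ᵥ∕2}`); `cΛ` is a displayed nonnegative real (print's `O(1)`), never a numeral; nothing of H3 ∕
(B) ∕ BetaPertH is discharged.  Nothing of Bałaban's is asserted or contested: «g_j sufficiently small» is typed as an
explicit window, nothing more.  NE7b NOT PRINTED ∕ NOT PROVED; spine 0∕9; rung (B)+1 on a FINITE torus — NOT infinite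
volume, NOT the mass gap, NOT Clay.  HONEST DEPENDENCY (cell): continuum YM on T⁴ ⇐ BetaPertH ∧ nine spine estimates (0/9
proved); BetaPertH ⇐ (D1) ∧ (D4) ∧ CAP+tail; G-an2-4 gates asym, D1 and NE2/3/4.  This file changes none of it.
-/

open Finset
open Literature.MathematicalPhysics.QuantumFieldTheory.Balaban1983to89
open T4PersistenceDictionary T4PrintedShapeBanking
open Summit.QuantumFields.BalabanUV.T4Continuum.HistoryConstants
open Summit.QuantumFields.BalabanUV.T4Continuum.HistoryBankingSharpShares

namespace Summit.QuantumFields.BalabanUV.T4Continuum.HistoryBankingVolumeWindow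

noncomputable section

/-! ## §1 The letters: print's volume weight capped at the cutoff, the pinned per-cube cost, the lag -/

section Letters

/-- **PRINT'S VOLUME LETTER** (per cube, capped at the cutoff): `uvol cΛ g K t = cΛ·ℓ_{t∧K}`, `ℓ_j = log g_j⁻²` — the
reading `Λ K j = exp(O(1)·log g_j⁻²)` per cube of [B16] p. 380's «O(1) log g_j⁻²|Z_j|» (LOCATOR; the row OWNER's shape in
`B16HistoryInputFamily`), `cΛ` the displayed `O(1)`; levels beyond the cutoff read the cutoff's letter. [folklore] -/
def uvol (cΛ : ℝ) (g : ℕ → ℝ) (K t : ℕ) : ℝ := cΛ * ell g (min t K)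

/-- **THE PER-CUBE LEVEL COST PINNED AT PRINT'S LETTER**: `lamVol cΛ g K t = exp (cΛ·ℓ_{t∧K})`. [folklore] -/
def lamVol (cΛ : ℝ) (g : ℕ → ℝ) (K t : ℕ) : ℝ := Real.exp (uvol cΛ g K t)

/-- **THE LAG OF RECORD**: `jvol d Lu = max 1 ⌈log₂ ⌈2·(1122^d·16·21^d·Lu)⌉⌉` — the least lag making M5-2's `hsmall` hold
(`hsmall_jvol`). [folklore] -/
def jvol (d : ℕ) (Lu : ℝ) : ℕ := max 1 (Nat.clog 2 ⌈2 * ((1122 : ℝ) ^ d * 16 * 21 ^ d * Lu)⌉₊)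

variable {cΛ : ℝ} {g : ℕ → ℝ} {K : ℕ}

/-- on the performed range the letter is `cΛ·ℓ_t`. [folklore] -/
theorem uvol_of_le (cΛ : ℝ) (g : ℕ → ℝ) {K t : ℕ} (ht : t ≤ K) : uvol cΛ g K t = cΛ * ell g t := by
  rw [uvol, min_eq_left ht]

/-- beyond the cutoff the letter is the cutoff's. [folklore] -/
theorem uvol_of_ge (cΛ : ℝ) (g : ℕ → ℝ) {K t : ℕ} (ht : K ≤ t) : uvol cΛ g K t = cΛ * ell g K := by
  rw [uvol, min_eq_right ht]

/-- the letter is nonnegative (`cΛ ≥ 0`, `ℓ_j ≥ 1` on the performed range). [folklore] -/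
theorem uvol_nonneg (hc : 0 ≤ cΛ) (hℓ : ∀ j, j ≤ K → 1 ≤ ell g j) (t : ℕ) : 0 ≤ uvol cΛ g K t :=
  mul_nonneg hc (zero_le_one.trans (hℓ _ (min_le_right t K)))

/-- the pinned cost's logarithm IS the letter. [folklore] -/
@[simp] theorem log_lamVol (cΛ : ℝ) (g : ℕ → ℝ) (K t : ℕ) : Real.log (lamVol cΛ g K t) = uvol cΛ g K t :=
  Real.log_exp _

/-- the pinned cost is at least one (`B16HistoryInputFamily.HistFactors.one_le_Λ`'s shape). [folklore] -/
theorem one_le_lamVol (hc : 0 ≤ cΛ) (hℓ : ∀ j, j ≤ K → 1 ≤ ell g j) (t : ℕ) : 1 ≤ lamVol cΛ g K t :=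
  Real.one_le_exp_iff.2 (uvol_nonneg hc hℓ t)

/-- the pinned cost is positive. [folklore] -/
theorem lamVol_pos (cΛ : ℝ) (g : ℕ → ℝ) (K t : ℕ) : 0 < lamVol cΛ g K t := Real.exp_pos _

/-- `1 ≤ jvol d Lu` (M5-2's `hj1`). [folklore] -/
theorem one_le_jvol (d : ℕ) (Lu : ℝ) : 1 ≤ jvol d Lu := le_max_left _ _

/-- **`hsmall` IS AN IDENTITY OF THE LAG**: `1122^d·16·21^d·Lu ≤ 2^{jvol d Lu}∕2`. [folklore] -/
theorem hsmall_jvol (d : ℕ) (Lu : ℝ) : (1122 : ℝ) ^ d * 16 * 21 ^ d * Lu ≤ 2 ^ jvol d Lu / 2 := by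
  set X : ℝ := (1122 : ℝ) ^ d * 16 * 21 ^ d * Lu with hX
  have h1 : 2 * X ≤ (⌈2 * X⌉₊ : ℝ) := Nat.le_ceil _
  have h2 : (⌈2 * X⌉₊ : ℝ) ≤ (2 : ℝ) ^ Nat.clog 2 ⌈2 * X⌉₊ := by
    exact_mod_cast Nat.le_pow_clog one_lt_two _
  have h3 : (2 : ℝ) ^ Nat.clog 2 ⌈2 * X⌉₊ ≤ 2 ^ jvol d Lu :=
    pow_le_pow_right₀ one_le_two (by unfold jvol; exact le_max_right _ _)
  rw [le_div_iff₀ (by norm_num : (0 : ℝ) < 2)]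
  linarith

end Letters

/-! ## §2 (2.7): the capped letter grows by at most `1 + β₀` along the performed range — `hLu` for every lag -/

section Growth

variable {g : ℕ → ℝ} {β' β₀ cΛ : ℝ} {K p : ℕ}

/-- (2.7) with `p = 1` as printed: `ℓ_n ≤ (1+β₀)·ℓ_m` for `m < n ≤ K`. [folklore] -/
theorem ell_later_le_of_flowIneq27_one (h27 : B14.FlowIneq27 g β' β₀ 1 K) {m n : ℕ} (hmn : m < n) (hn : n ≤ K) :
    ell g n ≤ (1 + β₀) * ell g m := by
  have h := (h27 m n hmn hn).1
  simp only [pow_one] at h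
  exact h

/-- (2.7) with ANY exponent `p ≥ 1` (the form `HistoryFlow.flowBinders_of_tuned` supplies at `p₀`) gives the `p = 1`
consequence `ℓ_n ≤ (1+β₀)·ℓ_m` (`m < n ≤ K`), for `β₀ ≥ 0` and `ℓ ≥ 0` on the performed range:
`ℓ_n^{p} ≤ (1+β₀)ℓ_m^{p} ≤ ((1+β₀)ℓ_m)^{p}`. [folklore] -/
theorem ell_later_le_of_flowIneq27 (hp : 1 ≤ p) (h27 : B14.FlowIneq27 g β' β₀ p K) (hβ₀ : 0 ≤ β₀)
    (hℓ : ∀ j, j ≤ K → 0 ≤ ell g j) {m n : ℕ} (hmn : m < n) (hn : n ≤ K) : ell g n ≤ (1 + β₀) * ell g m := by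
  have h := (h27 m n hmn hn).1
  change ell g n ^ p ≤ (1 + β₀) * ell g m ^ p at h
  have hm0 : 0 ≤ ell g m := hℓ m (by omega)
  have hn0 : 0 ≤ ell g n := hℓ n hn
  have hp0 : p ≠ 0 := by omega
  have h1 : (1 + β₀) ≤ (1 + β₀) ^ p := le_self_pow₀ (by linarith) hp0
  have h2 : ell g n ^ p ≤ ((1 + β₀) * ell g m) ^ p := by
    rw [mul_pow]
    exact h.trans (mul_le_mul_of_nonneg_right h1 (pow_nonneg hm0 _))
  exact (pow_le_pow_iff_left₀ hn0 (mul_nonneg (by linarith) hm0) hp0).1 h2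

/-- **`hLu` AT PRINT'S LETTER, FOR EVERY LAG**: if `ℓ_n ≤ (1+β₀)·ℓ_m` for `m < n ≤ K` ((2.7)), `β₀ ≥ 0`, `cΛ ≥ 0` and
`ℓ ≥ 1` on the performed range, then `uvol cΛ g K (t+i) ≤ (1+β₀)·uvol cΛ g K t` for ALL `t, i` (the cap at `K` makes the
unperformed levels read the cutoff's letter). [folklore] -/
theorem uvol_later_le (hmono : ∀ m n, m < n → n ≤ K → ell g n ≤ (1 + β₀) * ell g m) (hβ₀ : 0 ≤ β₀) (hc : 0 ≤ cΛ)
    (hℓ : ∀ j, j ≤ K → 1 ≤ ell g j) (t i : ℕ) : uvol cΛ g K (t + i) ≤ (1 + β₀) * uvol cΛ g K t := by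
  have hle : min t K ≤ min (t + i) K := min_le_min_right K (Nat.le_add_right t i)
  rcases hle.eq_or_lt with heq | hlt
  · unfold uvol
    rw [← heq]
    have h0 : 0 ≤ cΛ * ell g (min t K) := mul_nonneg hc (zero_le_one.trans (hℓ _ (min_le_right t K)))
    exact le_mul_of_one_le_left h0 (by linarith)
  · unfold uvol
    have h := hmono _ _ hlt (min_le_right _ _)
    calc cΛ * ell g (min (t + i) K) ≤ cΛ * ((1 + β₀) * ell g (min t K)) := mul_le_mul_of_nonneg_left h hc
      _ = (1 + β₀) * (cΛ * ell g (min t K)) := by ring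

end Growth

/-! ## §3 The volume window (HYPOTHESIS SHAPE) and the four value displays at the letter -/

section Window

/-- **THE VOLUME WINDOW** (HYPOTHESIS SHAPE — a `ForSmallCouplings`-type smallness of the run's couplings, K-UNIFORM: every
clause reads one performed step's `ℓ_j = log g_j⁻²` against constants; the sibling `HistoryBankingVolumeSupply` reduces it to
ONE threshold `ℓ_j ≥ ℓ⋆ᵥ`, hence to `g_j ≤ γ ≤ e^{−ℓ⋆ᵥ∕2}`).  Letters: `r` the (2.5) exponent, `C.q′` the floor power,
`C.p₀`∕`C.A₀` the profile, `cΛ ≥ 0` print's volume `O(1)` (displayed, never a numeral), `θᵥ` the volume slack of the END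
(`HistoryBankingVolumePlug.credit_mul_volume_le_shapeTH`), `Lu`∕`jl` the calibration the clauses are read at (of record:
`Lu = 1 + β₀`, `jl = jvol d (1+β₀)`); `κ₂`, `κᵥ` the two exponent GAPS fixed by the bookkeeping equations `1 + κ₂ = r·q′`
(the letter's one power of `ℓ` against the floor's `R^{q′} ≥ ℓ^{r q′}`) and `1 + κᵥ = 2p₀` (against the quadratic birth
credit `p₀(g_j)² = A₀²ℓ^{2p₀}`).  The four clauses (all `j ≤ K`): (WV1) `6(561^d·jl·Lu + 1122^d·Lu)·cΛ ≤ E₂·ℓ_j^{κ₂}` — the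
flat ledger's per-step charge against the floor; (WV2) `15·126^d·cΛ ≤ E₂·ℓ_j^{κ₂}`; (WV3) `24·126^d·cΛ ≤ E₃·ℓ_j^{κ₂}` — the
young-birth and size charges; (WV4) `2^{d+3}·cΛ ≤ θᵥ·A₀²·ℓ_j^{κᵥ}` — the class-linear volume remainder against the volume
slack.  Nothing of Bałaban's is asserted: the structure is a smallness condition on OUR letters. [folklore] -/
structure VolumeWindow (C : T4PrintedShapeBanking.Consts) (d K r κ₂ κᵥ : ℕ) (cΛ θv Lu : ℝ) (jl : ℕ) (g : ℕ → ℝ) :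
    Prop where
  /-- exponent bookkeeping against the floor ∕ size power: `1 + κ₂ = r·q′` -/
  expF : 1 + κ₂ = r * C.q'
  /-- exponent bookkeeping against the quadratic birth credit: `1 + κᵥ = 2p₀` -/
  expV : 1 + κᵥ = 2 * C.p₀
  /-- the logarithms are at least one on the performed range -/
  one_le_ell : ∀ j, j ≤ K → 1 ≤ ell g j
  /-- (WV1) -/
  wΦ : ∀ j, j ≤ K → 6 * (561 ^ d * jl * Lu + 1122 ^ d * Lu) * cΛ ≤ C.E₂ * ell g j ^ κ₂
  /-- (WV2) -/
  wE₂ : ∀ j, j ≤ K → 15 * 126 ^ d * cΛ ≤ C.E₂ * ell g j ^ κ₂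
  /-- (WV3) -/
  wE₃ : ∀ j, j ≤ K → 24 * 126 ^ d * cΛ ≤ C.E₃ * ell g j ^ κ₂
  /-- (WV4) -/
  wV : ∀ j, j ≤ K → 2 ^ (d + 3) * cΛ ≤ θv * C.A₀ ^ 2 * ell g j ^ κᵥ

variable {C : T4PrintedShapeBanking.Consts} {d K r κ₂ κᵥ jl : ℕ} {cΛ θv Lu : ℝ} {g : ℕ → ℝ} {R : ℕ → ℕ}

/-- one clause step: from `a·cΛ ≤ E·ℓ^{κ}` and `1 + κ = e` to `(cΛ·ℓ)·a ≤ E·ℓ^{e}` (`ℓ ≥ 0`). [folklore] -/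
theorem letter_mul_le_of_clause {a E ℓ : ℝ} {κ e : ℕ} (hexp : 1 + κ = e) (hℓ : 0 ≤ ℓ) (h : a * cΛ ≤ E * ℓ ^ κ) :
    cΛ * ℓ * a ≤ E * ℓ ^ e := by
  have h1 : cΛ * ℓ * a = a * cΛ * ℓ := by ring
  have h2 : E * ℓ ^ e = E * ℓ ^ κ * ℓ := by rw [← hexp, add_comm, pow_succ]; ring
  rw [h1, h2]
  exact mul_le_mul_of_nonneg_right h hℓ

/-- the LOWER (2.5) envelope raised to the floor power: `ℓ_t^{r} ≤ R_t` ⇒ `ℓ_t^{r·q′} ≤ R_t^{q′}` (`ℓ_t ≥ 0`). [folklore] -/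
theorem ell_pow_mul_le {t : ℕ} (hℓ : 0 ≤ ell g t) (hlow : ell g t ^ r ≤ (R t : ℝ)) (q : ℕ) :
    ell g t ^ (r * q) ≤ (R t : ℝ) ^ q := by
  rw [pow_mul]
  exact pow_le_pow_left₀ (pow_nonneg hℓ _) hlow q

/-- **`huΦ` AT PRINT'S LETTER**: under the window and the lower (2.5) envelope `ℓ_t^{r} ≤ R_t` (`t ≤ K`), `E₂ ≥ 0`:
`uvol cΛ g K t·6(561^d·jl·Lu + 1122^d·Lu) ≤ floorK C K R t` for `t ≤ K`. [folklore] -/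
theorem huΦ_uvol (hW : VolumeWindow C d K r κ₂ κᵥ cΛ θv Lu jl g) (hE₂ : 0 ≤ C.E₂)
    (hlow : ∀ t, t ≤ K → ell g t ^ r ≤ (R t : ℝ)) (t : ℕ) (ht : t ≤ K) :
    uvol cΛ g K t * (6 * (561 ^ d * jl * Lu + 1122 ^ d * Lu)) ≤ floorK C K R t := by
  have hℓ : 0 ≤ ell g t := zero_le_one.trans (hW.one_le_ell t ht)
  rw [uvol_of_le cΛ g ht, floorK, if_pos ht]
  calc cΛ * ell g t * (6 * (561 ^ d * jl * Lu + 1122 ^ d * Lu)) ≤ C.E₂ * ell g t ^ (r * C.q') :=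
        letter_mul_le_of_clause hW.expF hℓ (hW.wΦ t ht)
    _ ≤ C.E₂ * (R t : ℝ) ^ C.q' := mul_le_mul_of_nonneg_left (ell_pow_mul_le hℓ (hlow t ht) _) hE₂

/-- **`huE₂` AT PRINT'S LETTER**: `uvol cΛ g K n·15·126^d ≤ E₂·R_n^{q′}` for `n ≤ K`. [folklore] -/
theorem huE₂_uvol (hW : VolumeWindow C d K r κ₂ κᵥ cΛ θv Lu jl g) (hE₂ : 0 ≤ C.E₂)
    (hlow : ∀ t, t ≤ K → ell g t ^ r ≤ (R t : ℝ)) (n : ℕ) (hn : n ≤ K) :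
    uvol cΛ g K n * (15 * 126 ^ d) ≤ C.E₂ * (R n : ℝ) ^ C.q' := by
  have hℓ : 0 ≤ ell g n := zero_le_one.trans (hW.one_le_ell n hn)
  rw [uvol_of_le cΛ g hn]
  calc cΛ * ell g n * (15 * 126 ^ d) ≤ C.E₂ * ell g n ^ (r * C.q') :=
        letter_mul_le_of_clause hW.expF hℓ (hW.wE₂ n hn)
    _ ≤ C.E₂ * (R n : ℝ) ^ C.q' := mul_le_mul_of_nonneg_left (ell_pow_mul_le hℓ (hlow n hn) _) hE₂

/-- **`huE₃` AT PRINT'S LETTER**: `uvol cΛ g K n·24·126^d ≤ E₃·R_n^{q′}` for `n ≤ K` (`E₃ ≥ 0`). [folklore] -/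
theorem huE₃_uvol (hW : VolumeWindow C d K r κ₂ κᵥ cΛ θv Lu jl g) (hE₃ : 0 ≤ C.E₃)
    (hlow : ∀ t, t ≤ K → ell g t ^ r ≤ (R t : ℝ)) (n : ℕ) (hn : n ≤ K) :
    uvol cΛ g K n * (24 * 126 ^ d) ≤ C.E₃ * (R n : ℝ) ^ C.q' := by
  have hℓ : 0 ≤ ell g n := zero_le_one.trans (hW.one_le_ell n hn)
  rw [uvol_of_le cΛ g hn]
  calc cΛ * ell g n * (24 * 126 ^ d) ≤ C.E₃ * ell g n ^ (r * C.q') :=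
        letter_mul_le_of_clause hW.expF hℓ (hW.wE₃ n hn)
    _ ≤ C.E₃ * (R n : ℝ) ^ C.q' := mul_le_mul_of_nonneg_left (ell_pow_mul_le hℓ (hlow n hn) _) hE₃

/-- **`huV` AT PRINT'S LETTER** (the volume-slack display of `HistoryBankingVolumePlug.credit_mul_volume_le_shapeTH`, per
performed birth step): `2^{d+3}·uvol cΛ g K j ≤ θᵥ·p₀(g_j)²` for `j ≤ K`. [folklore] -/
theorem huV_uvol (hW : VolumeWindow C d K r κ₂ κᵥ cΛ θv Lu jl g) (j : ℕ) (hj : j ≤ K) :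
    2 ^ (d + 3) * uvol cΛ g K j ≤ θv * p0Profile C.A₀ C.p₀ (g j) ^ 2 := by
  have hℓ : 0 ≤ ell g j := zero_le_one.trans (hW.one_le_ell j hj)
  rw [uvol_of_le cΛ g hj, p0Profile_eq]
  have h := letter_mul_le_of_clause (a := 2 ^ (d + 3)) (E := θv * C.A₀ ^ 2) hW.expV hℓ (hW.wV j hj)
  calc 2 ^ (d + 3) * (cΛ * ell g j) = cΛ * ell g j * 2 ^ (d + 3) := by ring
    _ ≤ θv * C.A₀ ^ 2 * ell g j ^ (2 * C.p₀) := h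
    _ = θv * (C.A₀ * ell g j ^ C.p₀) ^ 2 := by rw [mul_pow, ← pow_mul, mul_comm C.p₀ 2]; ring

end Window

/-! ## §4 The bundle of M5-2c's calibration binders and its discharge at the letter -/

section Displays

/-- **M5-2c's VOLUME CALIBRATION, BUNDLED** (DISPLAY SHAPE): the eight binders `hu ∕ hLu0 ∕ hj1 ∕ hLu ∕ hsmall ∕ huΦ ∕ huE₂ ∕
huE₃` of `HistoryBankingVolumePlug.exp_volume_le_genT` ∕ `credit_mul_volume_le_shapeTH` VERBATIM (weight `u`, growth constant
`Lu`, lag `jl`), i.e. — at `u := fun t => log (Φf.Λ K t)` — the fields `hLu0 ∕ hj1 ∕ hLu ∕ hsmall ∕ huΦ ∕ huE₂ ∕ huE₃` of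
`HistoryRealiseCellsRunAssemblyWTVSData.HistReadData` at one cutoff `K`. [folklore] -/
structure VolumeDisplays (C : T4PrintedShapeBanking.Consts) (d K : ℕ) (R : ℕ → ℕ) (u : ℕ → ℝ) (Lu : ℝ) (jl : ℕ) :
    Prop where
  /-- the weight is nonnegative -/
  hu : ∀ n, 0 ≤ u n
  /-- the growth constant is positive -/
  hLu0 : 0 < Lu
  /-- the lag is at least one -/
  hj1 : 1 ≤ jl
  /-- growth over the lag -/
  hLu : ∀ t i, i ≤ jl → u (t + i) ≤ Lu * u t
  /-- the lag beats the flat ledger's geometric constant -/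
  hsmall : (1122 : ℝ) ^ d * 16 * 21 ^ d * Lu ≤ 2 ^ jl / 2
  /-- the per-step charge against the floor -/
  huΦ : ∀ t, t ≤ K → u t * (6 * (561 ^ d * jl * Lu + 1122 ^ d * Lu)) ≤ floorK C K R t
  /-- the young-birth charge -/
  huE₂ : ∀ n, n ≤ K → u n * (15 * 126 ^ d) ≤ C.E₂ * (R n : ℝ) ^ C.q'
  /-- the size charge -/
  huE₃ : ∀ n, n ≤ K → u n * (24 * 126 ^ d) ≤ C.E₃ * (R n : ℝ) ^ C.q'

variable {C : T4PrintedShapeBanking.Consts} {d K r κ₂ κᵥ : ℕ} {cΛ θv β₀ : ℝ} {g : ℕ → ℝ} {R : ℕ → ℕ}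

/-- **THE VOLUME CALIBRATION DISCHARGED AT PRINT'S LETTER**: with (2.7)'s consequence `ℓ_n ≤ (1+β₀)ℓ_m` (`m < n ≤ K`),
`β₀ ≥ 0`, `cΛ ≥ 0`, `E₂, E₃ ≥ 0`, the lower (2.5) envelope `ℓ_t^{r} ≤ R_t` (`t ≤ K`) and the window read at
`Lu := 1 + β₀`, `jl := jvol d (1+β₀)`:
`VolumeDisplays C d K R (uvol cΛ g K) (1 + β₀) (jvol d (1 + β₀))`. [folklore] -/
theorem volumeDisplays_sharp (hmono : ∀ m n, m < n → n ≤ K → ell g n ≤ (1 + β₀) * ell g m) (hβ₀ : 0 ≤ β₀)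
    (hc : 0 ≤ cΛ) (hE₂ : 0 ≤ C.E₂) (hE₃ : 0 ≤ C.E₃) (hlow : ∀ t, t ≤ K → ell g t ^ r ≤ (R t : ℝ))
    (hW : VolumeWindow C d K r κ₂ κᵥ cΛ θv (1 + β₀) (jvol d (1 + β₀)) g) :
    VolumeDisplays C d K R (uvol cΛ g K) (1 + β₀) (jvol d (1 + β₀)) where
  hu := uvol_nonneg hc hW.one_le_ell
  hLu0 := by linarith
  hj1 := one_le_jvol d _
  hLu t i _ := uvol_later_le hmono hβ₀ hc hW.one_le_ell t i
  hsmall := hsmall_jvol d _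
  huΦ := huΦ_uvol hW hE₂ hlow
  huE₂ := huE₂_uvol hW hE₂ hlow
  huE₃ := huE₃_uvol hW hE₃ hlow

/-- the same from (2.7) at any exponent `p ≥ 1` (`B14.FlowIneq27 g β′ β₀ p K`) and (2.5) itself (`B14.IsRj L r (g_t) (R_t)`,
`t ≤ K`, whose second conjunct IS the lower envelope). [folklore] -/
theorem volumeDisplays_sharp_of_isRj {β' : ℝ} {p L : ℕ} (hp : 1 ≤ p) (h27 : B14.FlowIneq27 g β' β₀ p K) (hβ₀ : 0 ≤ β₀)
    (hc : 0 ≤ cΛ) (hE₂ : 0 ≤ C.E₂) (hE₃ : 0 ≤ C.E₃) (hRj : ∀ t, t ≤ K → B14.IsRj L r (g t) (R t))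
    (hW : VolumeWindow C d K r κ₂ κᵥ cΛ θv (1 + β₀) (jvol d (1 + β₀)) g) :
    VolumeDisplays C d K R (uvol cΛ g K) (1 + β₀) (jvol d (1 + β₀)) :=
  volumeDisplays_sharp
    (fun _ _ hmn hn => ell_later_le_of_flowIneq27 hp h27 hβ₀ (fun j hj => zero_le_one.trans (hW.one_le_ell j hj)) hmn hn)
    hβ₀ hc hE₂ hE₃ (fun t ht => by obtain ⟨_, _, h, _⟩ := hRj t ht; exact h) hW

/-- **THE RECORD-FACING FORM** (a per-cube cost PINNED at the letter, `log (Λ t) = uvol cΛ g K t` — e.g. `Λ := lamVol cΛ g K`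
by `log_lamVol`): the displays hold for the weight `fun t => log (Λ t)`, i.e. LITERALLY the `HistReadData` fields
`hLu0 ∕ hj1 ∕ hLu ∕ hsmall ∕ huΦ ∕ huE₂ ∕ huE₃` at the cutoff `K` with `Lu K := 1 + β₀`, `jl K := jvol d (1+β₀)`. [folklore] -/
theorem volumeDisplays_of_log_eq {Λ : ℕ → ℝ} (hΛ : ∀ t, Real.log (Λ t) = uvol cΛ g K t)
    (hmono : ∀ m n, m < n → n ≤ K → ell g n ≤ (1 + β₀) * ell g m) (hβ₀ : 0 ≤ β₀) (hc : 0 ≤ cΛ) (hE₂ : 0 ≤ C.E₂)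
    (hE₃ : 0 ≤ C.E₃) (hlow : ∀ t, t ≤ K → ell g t ^ r ≤ (R t : ℝ))
    (hW : VolumeWindow C d K r κ₂ κᵥ cΛ θv (1 + β₀) (jvol d (1 + β₀)) g) :
    VolumeDisplays C d K R (fun t => Real.log (Λ t)) (1 + β₀) (jvol d (1 + β₀)) := by
  have h : (fun t => Real.log (Λ t)) = uvol cΛ g K := funext hΛ
  rw [h]
  exact volumeDisplays_sharp hmono hβ₀ hc hE₂ hE₃ hlow hW

/-- **`huV` IN THE RECORD's SHAPE** for a pinned cost: `2^{d+3}·log (Λ j) ≤ θᵥ·p₀(g_j)²` at every performed step `j ≤ K`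
(the `HistReadData.huV` inequality at one birth step; the priced members' births are performed steps). [folklore] -/
theorem huV_of_log_eq {Lu : ℝ} {jl : ℕ} {Λ : ℕ → ℝ} (hΛ : ∀ t, Real.log (Λ t) = uvol cΛ g K t)
    (hW : VolumeWindow C d K r κ₂ κᵥ cΛ θv Lu jl g) (j : ℕ) (hj : j ≤ K) :
    2 ^ (d + 3) * Real.log (Λ j) ≤ θv * p0Profile C.A₀ C.p₀ (g j) ^ 2 := by
  rw [hΛ]
  exact huV_uvol hW j hj

/-- `huV` lifted to a finite family of events read through `sh` (kind-`0` events at performed steps): the shape of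
`HistoryBankingVolumePlug.credit_mul_volume_le_shapeTH`'s binder `huθ` ∕ the record's `huV` over one member's events. [folklore] -/
theorem huV_events_of_log_eq {ε : Type*} {Lu : ℝ} {jl : ℕ} {Λ : ℕ → ℝ} (hΛ : ∀ t, Real.log (Λ t) = uvol cΛ g K t)
    (hW : VolumeWindow C d K r κ₂ κᵥ cΛ θv Lu jl g) (sh : ε → PEv) (E : Finset ε)
    (hsteps : ∀ e ∈ E, (sh e).kind = 0 → (sh e).step ≤ K) :
    ∀ e ∈ E, (sh e).kind = 0 →
      2 ^ (d + 3) * Real.log (Λ (sh e).step) ≤ θv * p0Profile C.A₀ C.p₀ (g (sh e).step) ^ 2 :=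
  fun e he h0 => huV_of_log_eq hΛ hW _ (hsteps e he h0)

/-- **AT THE PINNED COST `lamVol`** (one call): the seven record fields at `Λ := lamVol cΛ g K`. [folklore] -/
theorem volumeDisplays_lamVol (hmono : ∀ m n, m < n → n ≤ K → ell g n ≤ (1 + β₀) * ell g m) (hβ₀ : 0 ≤ β₀)
    (hc : 0 ≤ cΛ) (hE₂ : 0 ≤ C.E₂) (hE₃ : 0 ≤ C.E₃) (hlow : ∀ t, t ≤ K → ell g t ^ r ≤ (R t : ℝ))
    (hW : VolumeWindow C d K r κ₂ κᵥ cΛ θv (1 + β₀) (jvol d (1 + β₀)) g) :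
    VolumeDisplays C d K R (fun t => Real.log (lamVol cΛ g K t)) (1 + β₀) (jvol d (1 + β₀)) :=
  volumeDisplays_of_log_eq (log_lamVol cΛ g K) hmono hβ₀ hc hE₂ hE₃ hlow hW

/-- `huV` at the pinned cost `lamVol`, per performed step. [folklore] -/
theorem huV_lamVol {Lu : ℝ} {jl : ℕ} (hW : VolumeWindow C d K r κ₂ κᵥ cΛ θv Lu jl g) (j : ℕ) (hj : j ≤ K) :
    2 ^ (d + 3) * Real.log (lamVol cΛ g K j) ≤ θv * p0Profile C.A₀ C.p₀ (g j) ^ 2 :=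
  huV_of_log_eq (log_lamVol cΛ g K) hW j hj

end Displays

end

end Summit.QuantumFields.BalabanUV.T4Continuum.HistoryBankingVolumeWindow
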